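import Summits.NavierStokesRegularity.NavierStokesRegularity.Theorems.WakeRatchetExtractionAction

/-!
# WakeRatchetExtractionLaw — LINE g9-1 «clocked frames», part 5/7: ⟨22744⟩ `WakeRatchet.MinimalBlowupExtraction`

Ideator ns-idea-1 g9, LINE g9-1 «clocked frames» (critic of record idea-crit-3): part 5 of 7 of the split landing kit of
`extraction_proved.lean` (sha16 849d037365163546, the sorry-free proof of route item ⟨stmt-NavierStokesRegularity-22744⟩
`WakeRatchet.MinimalBlowupExtraction`), cut at the author's seams with every declaration VERBATIM; parts chain by import
(1 Ascoli → 2 Frames → 3 FrameLip → 4 Action → 5 Law → 6 Clock → 7 MinimalBlowupExtraction).  MODEL lattice only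
(Tao 2016 averaged Navier–Stokes cascade); no summit is proved by a line — part 7 closes ONE crux (K2) of route WakeRatchet.

This part: (E3b) the law passes to the continuous limit: `closureLaw_holds : ClosureLaw` (frame law in integral form, dominated
convergence on `[σ₀, σ]`, differentiation of the limit identity), whence `stubClosure_holds` and `stubOmegaLimit_holds`.
-/

noncomputable section

set_option linter.dupNamespace false

namespace Summit.NavierStokesRegularity.NavierStokesRegularity.Cruxes.MinimalBlowupExtraction.ClockedFrames

open Set Filter Topology MeasureTheory
open scoped RealInnerProductSpace
open Literature.Analysis.FluidPDE Literature.Analysis.FluidPDE.TaoCascade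
open Summit.NavierStokesRegularity.NavierStokesRegularity.Cruxes.MinimalBlowupExtraction.Extraction
  (exists_subseq_continuousLimit_param)
open Summit.NavierStokesRegularity.NavierStokesRegularity.Theorems.DSSOneShift
  (hasDerivWithinAt_shellVec bigLam_zpow_eq_rpow)
open Summit.NavierStokesRegularity.NavierStokesRegularity.Theorems.WakeRatchetCritical
  (tableQ_smul tableA_smul tableB_smul_smul continuous_tableB)
open Summit.NavierStokesRegularity.NavierStokesRegularity.Theorems.TransitMassLedgerEnergy
  (continuous_tableQ continuous_tableA continuous_tableB_comp)
open Summit.NavierStokesRegularity.NavierStokesRegularity.Cruxes.MinimalBlowupExtraction.TableCont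

variable {ε₀ : ℝ} {α : Fin 4 → Fin 4 → Fin 4 → ℤ × ℤ × ℤ → ℝ} {X₀ : Fin 4 → ℝ} {ν T C c : ℝ}
  {X : Fin 4 → ℤ → ℝ → ℝ} {c' κ₁ κ₂ : ℝ} {τ : ℕ → ℝ}

/-! ## (E3b) The law passes to the continuous limit: `ClosureLaw` -/

/-- The renormalised viscous vector field at shell `n` of a wave `V` with covariant viscosity parameter `p`,
at log-time `u` (the right-hand side of `IsEternalVisc.law`). -/
def vfield (ε₀ : ℝ) (α : Fin 4 → Fin 4 → Fin 4 → ℤ × ℤ × ℤ → ℝ) (p : ℝ) (V : ℤ → ℝ → Em 4) (n : ℤ)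
    (u : ℝ) : Em 4 :=
  -((1 : ℝ) • V n u) + tableQ α (V n u) + bigLam ε₀ • tableA α (V (n - 1) u)
    + (bigLam ε₀)⁻¹ • tableB α (V (n + 1) u) (V n u) - (p * ((1 + ε₀) ^ ((2 : ℝ) * n) * Real.exp (-u))) • V n u

section Law

variable {τ : ℕ → ℝ} {φ : ℕ → ℕ} {W : ℤ → ℝ → Em 4} {c' κ₁ κ₂ : ℝ}

/-- `frame_law` in `vfield` form. -/
theorem frame_law' (hP : Pinned ε₀ α X₀ ν T C c X) (hε : 0 < ε₀) (hclk : ClockedFiring ε₀ T c' κ₁ κ₂ X τ)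
    (j : ℕ) (n : ℤ) {u : ℝ} (hwin : Real.exp (-u) * (T - τ j) < T) :
    HasDerivAt (fun v => frame ε₀ T X j (-Real.log (T - τ j)) n v)
      (vfield ε₀ α (viscParam ε₀ ν T τ j) (fun m w => frame ε₀ T X j (-Real.log (T - τ j)) m w) n u) u :=
  frame_law hP hε hclk j n hwin

/-- The field along a frame is bounded by the equi-Lipschitz constant (it IS the derivative). -/
theorem norm_vfield_frame_le (hP : Pinned ε₀ α X₀ ν T C c X) (hε : 0 < ε₀)
    (hclk : ClockedFiring ε₀ T c' κ₁ κ₂ X τ) (j : ℕ) (n : ℤ) {a u : ℝ} (hu : a ≤ u)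
    (hwin : Real.exp (-a) * (T - τ j) < T) :
    ‖vfield ε₀ α (viscParam ε₀ ν T τ j) (fun m w => frame ε₀ T X j (-Real.log (T - τ j)) m w) n u‖ ≤
      lipK α ν C ε₀ κ₂ n a := by
  have gj : 0 < T - τ j := by linarith [(hclk j).2.1]
  have hwu : Real.exp (-u) * (T - τ j) < T := by
    have h1 : Real.exp (-u) ≤ Real.exp (-a) := Real.exp_le_exp.2 (by linarith)
    have h2 := mul_le_mul_of_nonneg_right h1 gj.le
    linarith
  have hwin' : Real.exp (-(u + -Real.log (T - τ j))) < T := by rw [exp_shift gj]; exact hwu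
  have h1 := frame_law' hP hε hclk j n hwu
  have h2 := hasDerivAt_frame hP j n (-Real.log (T - τ j)) hwin'
  rw [h1.unique h2]
  exact norm_frameDeriv_le hP hε hclk j n hu hwin

/-- The field along a frame is continuous on the window. -/
theorem continuousAt_vfield_frame (hP : Pinned ε₀ α X₀ ν T C c X) (hclk : ClockedFiring ε₀ T c' κ₁ κ₂ X τ)
    (j : ℕ) (n : ℤ) {u : ℝ} (hwin : Real.exp (-u) * (T - τ j) < T) :
    ContinuousAt
      (fun v => vfield ε₀ α (viscParam ε₀ ν T τ j) (fun m w => frame ε₀ T X j (-Real.log (T - τ j)) m w) n v)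
      u := by
  have gj : 0 < T - τ j := by linarith [(hclk j).2.1]
  have hwin' : Real.exp (-(u + -Real.log (T - τ j))) < T := by rw [exp_shift gj]; exact hwin
  have hF : ∀ m : ℤ, ContinuousAt (fun v => frame ε₀ T X j (-Real.log (T - τ j)) m v) u := fun m =>
    (hasDerivAt_frame hP j m (-Real.log (T - τ j)) hwin').continuousAt
  have hQ : ContinuousAt (fun v => tableQ α (frame ε₀ T X j (-Real.log (T - τ j)) n v)) u :=
    tendsto_tableQ_comp α (hF n)
  have hA : ContinuousAt (fun v => tableA α (frame ε₀ T X j (-Real.log (T - τ j)) (n - 1) v)) u :=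
    tendsto_tableA_comp α (hF (n - 1))
  have hB : ContinuousAt (fun v => tableB α (frame ε₀ T X j (-Real.log (T - τ j)) (n + 1) v)
      (frame ε₀ T X j (-Real.log (T - τ j)) n v)) u :=
    tendsto_tableB_comp α (hF (n + 1)) (hF n)
  have hs : Continuous (fun v : ℝ => viscParam ε₀ ν T τ j * ((1 + ε₀) ^ ((2 : ℝ) * n) * Real.exp (-v))) :=
    continuous_const.mul (continuous_const.mul (Real.continuous_exp.comp continuous_neg))
  unfold vfield
  beta_reduce
  refine ContinuousAt.sub (ContinuousAt.add (ContinuousAt.add (ContinuousAt.add ?_ hQ) ?_) ?_) ?_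
  · exact ContinuousAt.neg (ContinuousAt.const_smul (hF n) (1 : ℝ))
  · exact ContinuousAt.const_smul hA (bigLam ε₀)
  · exact ContinuousAt.const_smul hB ((bigLam ε₀)⁻¹)
  · exact ContinuousAt.smul hs.continuousAt (hF n)

/-- The limiting field is continuous. -/
theorem continuous_vfield_limit (hW : ∀ m : ℤ, Continuous (W m)) (νh : ℝ) (n : ℤ) :
    Continuous (fun u => vfield ε₀ α νh W n u) := by
  have hQ : Continuous (fun u => tableQ α (W n u)) := (continuous_tableQ α).comp (hW n)
  have hA : Continuous (fun u => tableA α (W (n - 1) u)) := (continuous_tableA α).comp (hW (n - 1))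
  have hB : Continuous (fun u => tableB α (W (n + 1) u) (W n u)) :=
    continuous_tableB_comp α (hW (n + 1)) (hW n)
  have hs : Continuous (fun u : ℝ => νh * ((1 + ε₀) ^ ((2 : ℝ) * n) * Real.exp (-u))) :=
    continuous_const.mul (continuous_const.mul (Real.continuous_exp.comp continuous_neg))
  unfold vfield
  beta_reduce
  refine Continuous.sub (Continuous.add (Continuous.add (Continuous.add ?_ hQ) ?_) ?_) ?_
  · exact Continuous.neg (Continuous.const_smul (hW n) (1 : ℝ))
  · exact Continuous.const_smul hA (bigLam ε₀)
  · exact Continuous.const_smul hB ((bigLam ε₀)⁻¹)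
  · exact Continuous.smul hs (hW n)

/-- Pointwise convergence of the fields along `φ`. -/
theorem tendsto_vfield (hconv : FramesConverge ε₀ T X τ φ W) {νh : ℝ}
    (hvp : Tendsto (fun j => viscParam ε₀ ν T τ (φ j)) atTop (𝓝 νh)) (n : ℤ) (u : ℝ) :
    Tendsto (fun j => vfield ε₀ α (viscParam ε₀ ν T τ (φ j))
      (fun m w => frame ε₀ T X (φ j) (-Real.log (T - τ (φ j))) m w) n u) atTop (𝓝 (vfield ε₀ α νh W n u)) := by
  have hF : ∀ m : ℤ, Tendsto (fun j => frame ε₀ T X (φ j) (-Real.log (T - τ (φ j))) m u) atTop (𝓝 (W m u)) :=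
    fun m => limit_pointwise hconv m u
  have hQ : Tendsto (fun j => tableQ α (frame ε₀ T X (φ j) (-Real.log (T - τ (φ j))) n u)) atTop
      (𝓝 (tableQ α (W n u))) := tendsto_tableQ_comp α (hF n)
  have hA : Tendsto (fun j => tableA α (frame ε₀ T X (φ j) (-Real.log (T - τ (φ j))) (n - 1) u)) atTop
      (𝓝 (tableA α (W (n - 1) u))) := tendsto_tableA_comp α (hF (n - 1))
  have hB : Tendsto (fun j => tableB α (frame ε₀ T X (φ j) (-Real.log (T - τ (φ j))) (n + 1) u)
      (frame ε₀ T X (φ j) (-Real.log (T - τ (φ j))) n u)) atTop (𝓝 (tableB α (W (n + 1) u) (W n u))) :=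
    tendsto_tableB_comp α (hF (n + 1)) (hF n)
  have hs : Tendsto (fun j => viscParam ε₀ ν T τ (φ j) * ((1 + ε₀) ^ ((2 : ℝ) * n) * Real.exp (-u))) atTop
      (𝓝 (νh * ((1 + ε₀) ^ ((2 : ℝ) * n) * Real.exp (-u)))) := hvp.mul_const _
  unfold vfield
  beta_reduce
  refine Tendsto.sub (Tendsto.add (Tendsto.add (Tendsto.add ?_ hQ) ?_) ?_) ?_
  · exact Tendsto.neg (Tendsto.const_smul (hF n) (1 : ℝ))
  · exact Tendsto.const_smul hA (bigLam ε₀)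
  · exact Tendsto.const_smul hB ((bigLam ε₀)⁻¹)
  · exact Tendsto.smul hs (hF n)

/-- **Integral form in the limit**: `W_n(σ) − W_n(σ₀) = ∫_{σ₀}^{σ} vfield(ν̂, W)`. -/
theorem limit_integral_form (hP : Pinned ε₀ α X₀ ν T C c X) (hε : 0 < ε₀)
    (hclk : ClockedFiring ε₀ T c' κ₁ κ₂ X τ) (hφ : StrictMono φ) (hconv : FramesConverge ε₀ T X τ φ W) {νh : ℝ}
    (hvp : Tendsto (fun j => viscParam ε₀ ν T τ (φ j)) atTop (𝓝 νh)) (n : ℤ) {σ₀ σ : ℝ} (hσ : σ₀ ≤ σ) :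
    ∫ u in σ₀..σ, vfield ε₀ α νh W n u = W n σ - W n σ₀ := by
  have hT : 0 < T := hP.2.1
  have hev := eventually_window_sub hε hT hclk hφ σ₀
  have hwu : ∀ j : ℕ, Real.exp (-σ₀) * (T - τ (φ j)) < T → ∀ u : ℝ, σ₀ ≤ u →
      Real.exp (-u) * (T - τ (φ j)) < T := by
    intro j hj u hu
    have gj : 0 < T - τ (φ j) := by linarith [(hclk (φ j)).2.1]
    have h1 : Real.exp (-u) ≤ Real.exp (-σ₀) := Real.exp_le_exp.2 (by linarith)
    have h2 := mul_le_mul_of_nonneg_right h1 gj.le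
    linarith
  -- the integral form of each frame
  have hframe : ∀ᶠ j in atTop, ∫ u in σ₀..σ, vfield ε₀ α (viscParam ε₀ ν T τ (φ j))
      (fun m w => frame ε₀ T X (φ j) (-Real.log (T - τ (φ j))) m w) n u =
      frame ε₀ T X (φ j) (-Real.log (T - τ (φ j))) n σ - frame ε₀ T X (φ j) (-Real.log (T - τ (φ j))) n σ₀ := by
    refine hev.mono fun j hj => ?_
    refine intervalIntegral.integral_eq_sub_of_hasDerivAt (fun u hu => ?_) ?_
    · rw [uIcc_of_le hσ] at hu
      exact frame_law' hP hε hclk (φ j) n (hwu j hj u hu.1)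
    · refine ContinuousOn.intervalIntegrable ?_
      rw [uIcc_of_le hσ]
      exact fun u hu => (continuousAt_vfield_frame hP hclk (φ j) n (hwu j hj u hu.1)).continuousWithinAt
  -- dominated convergence of the fields
  have hlim : Tendsto (fun j => ∫ u in σ₀..σ, vfield ε₀ α (viscParam ε₀ ν T τ (φ j))
      (fun m w => frame ε₀ T X (φ j) (-Real.log (T - τ (φ j))) m w) n u) atTop
      (𝓝 (∫ u in σ₀..σ, vfield ε₀ α νh W n u)) := by
    refine intervalIntegral.tendsto_integral_filter_of_dominated_convergence (fun _ => lipK α ν C ε₀ κ₂ n σ₀)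
      ?_ ?_ intervalIntegrable_const ?_
    · refine hev.mono fun j hj => ContinuousOn.aestronglyMeasurable (fun u hu => ?_) measurableSet_uIoc
      rw [Set.uIoc_of_le hσ] at hu
      exact (continuousAt_vfield_frame hP hclk (φ j) n (hwu j hj u hu.1.le)).continuousWithinAt
    · refine hev.mono fun j hj => ae_of_all _ fun u hu => ?_
      rw [Set.uIoc_of_le hσ] at hu
      exact norm_vfield_frame_le hP hε hclk (φ j) n hu.1.le hj
    · exact ae_of_all _ fun u _ => tendsto_vfield hconv hvp n u
  have hlim' : Tendsto (fun j => frame ε₀ T X (φ j) (-Real.log (T - τ (φ j))) n σ -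
      frame ε₀ T X (φ j) (-Real.log (T - τ (φ j))) n σ₀) atTop (𝓝 (∫ u in σ₀..σ, vfield ε₀ α νh W n u)) :=
    hlim.congr' hframe
  exact tendsto_nhds_unique hlim' ((limit_pointwise hconv n σ).sub (limit_pointwise hconv n σ₀))

/-- **ClosureLaw PROVED.**  By the integral form and the continuity of the limiting field (FTC-2). -/
theorem closureLaw_holds : ClosureLaw := by
  intro ε₀ R α X₀ ν T C c X hε hα hP c' κ₁ κ₂ τ hκ₁ hclk φ W νh hφ hνh hvp hconv n σ
  have hW : ∀ m : ℤ, Continuous (W m) := fun m => continuous_limit hP hε hclk hφ hconv m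
  have hΦ : Continuous (fun u => vfield ε₀ α νh W n u) := continuous_vfield_limit hW νh n
  -- `W n = W n (σ-1) + ∫_{σ-1}^{·} vfield` on `(σ-1, ∞)`
  have hG : HasDerivAt (fun s => W n (σ - 1) + ∫ u in (σ - 1)..s, vfield ε₀ α νh W n u)
      (vfield ε₀ α νh W n σ) σ := by
    have h := intervalIntegral.integral_hasDerivAt_right (hΦ.intervalIntegrable _ _)
      (hΦ.stronglyMeasurableAtFilter _ _) hΦ.continuousAt (a := σ - 1) (b := σ)
    exact h.const_add _
  have heq : W n =ᶠ[𝓝 σ] fun s => W n (σ - 1) + ∫ u in (σ - 1)..s, vfield ε₀ α νh W n u := by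
    filter_upwards [Ici_mem_nhds (show σ - 1 < σ by linarith)] with s hs
    rw [limit_integral_form hP hε hclk hφ hconv hvp n hs]
    abel
  have h := hG.congr_of_eventuallyEq heq
  show HasDerivAt (W n) (vfield ε₀ α νh W n σ) σ
  exact h

end Law

/-- **StubClosure PROVED.** -/
theorem stubClosure_holds : StubClosure := stubClosure_of closureLaw_holds closureAction_holds

/-- **StubOmegaLimit PROVED** (the last registered stub of LINE g9-1). -/
theorem stubOmegaLimit_holds : StubOmegaLimit :=
  stubOmegaLimit_of stubFrameSup_holds stubFrameLip_holds stubClosure_holds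

end Summit.NavierStokesRegularity.NavierStokesRegularity.Cruxes.MinimalBlowupExtraction.ClockedFrames

end
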